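import Literature.NumberTheory.LFunctions.WeilTwoPrimeCellsT120
import Literature.NumberTheory.LFunctions.WeilTwoPrimeMinorant
import Literature.NumberTheory.LFunctions.WeilTwoPrimeCellsT120NuPart42
import HarnessLib

/-!
# Two-prime minorant cells on `[0, 120]`: kernel facts for the partial moment sums, group 85

`cellsMomentQ₂₃ wL chunk q = nuPart_t_q` by `decide +kernel`, one declaration per (chunk, q). Pure proof file.
-/

noncomputable section

namespace Literature.NumberTheory.LFunctions

set_option maxHeartbeats 0 in
/-- The partial moment sum over chunk 0 at `q = 510`. [folklore] -/
theorem nuPartT120_0_510_eq :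
    cellsMomentQ₂₃ weilTwoPrimeCellsT120Level weilTwoPrimeCellsT120C0 510 = nuPartT120_0_510 := by
  decide +kernel

set_option maxHeartbeats 0 in
/-- The partial moment sum over chunk 1 at `q = 510`. [folklore] -/
theorem nuPartT120_1_510_eq :
    cellsMomentQ₂₃ weilTwoPrimeCellsT120Level weilTwoPrimeCellsT120C1 510 = nuPartT120_1_510 := by
  decide +kernel

set_option maxHeartbeats 0 in
/-- The partial moment sum over chunk 2 at `q = 510`. [folklore] -/
theorem nuPartT120_2_510_eq :
    cellsMomentQ₂₃ weilTwoPrimeCellsT120Level weilTwoPrimeCellsT120C2 510 = nuPartT120_2_510 := by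
  decide +kernel

set_option maxHeartbeats 0 in
/-- The partial moment sum over chunk 3 at `q = 510`. [folklore] -/
theorem nuPartT120_3_510_eq :
    cellsMomentQ₂₃ weilTwoPrimeCellsT120Level weilTwoPrimeCellsT120C3 510 = nuPartT120_3_510 := by
  decide +kernel

set_option maxHeartbeats 0 in
/-- The partial moment sum over chunk 4 at `q = 510`. [folklore] -/
theorem nuPartT120_4_510_eq :
    cellsMomentQ₂₃ weilTwoPrimeCellsT120Level weilTwoPrimeCellsT120C4 510 = nuPartT120_4_510 := by
  decide +kernel

set_option maxHeartbeats 0 in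
/-- The partial moment sum over chunk 5 at `q = 510`. [folklore] -/
theorem nuPartT120_5_510_eq :
    cellsMomentQ₂₃ weilTwoPrimeCellsT120Level weilTwoPrimeCellsT120C5 510 = nuPartT120_5_510 := by
  decide +kernel


end Literature.NumberTheory.LFunctions
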